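import Summits.QuantumFields.QCD.Theses.HeatSlicedQuarks

/-!
# Route `HeatSlicedQuarks`, item `Assembly` (stmt-QuantumFields-8878) — what the typed assembly is

The item is typed
`Assembly := SmallFieldUltracontractivity → ActionBoundsLowModes → ContinuumQCDExists → QCD`.
This file records, by pure logic over the route file (kernel-checked, no statement asserted
positively), where that statement sits among the route's other items:

* `assembly_of_handover` — the crux `RobustYangMillsHandover := ContinuumQCDExists → QCD`
  (stmt-QuantumFields-8892) gives `Assembly` outright: its first two hypotheses are idle;
* `handover_of_assembly`, `assembly_iff` — conversely `Assembly` together with the two typed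
  spectral cruxes `SmallFieldUltracontractivity` (8871) and `ActionBoundsLowModes` (8872) gives the
  handover back, so `Assembly ↔ (SmallFieldUltracontractivity ∧ ActionBoundsLowModes →
  RobustYangMillsHandover)`: relative to the two cruxes the item IS crux 8892;
* vacuity — `Assembly` also follows from `¬ SmallFieldUltracontractivity`, from
  `¬ ActionBoundsLowModes`, from `¬ ContinuumQCDExists` (the route's target 8870) and from `QCD`;
  and `not_assembly_iff` : `¬ Assembly ↔ 8871 ∧ 8872 ∧ 8870 ∧ ¬ QCD`, so no refutation exists short
  of refuting the summit conjunct;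
* `chain_eq_closes` — the pure-logic chain the item's docstring describes ("the last arrow is
  `RobustYangMillsHandover`; the engine arrows into `ContinuumQCDExists` are
  `InterleavedHeatSliceFlow`"), namely
  `SmallFieldUltracontractivity → ActionBoundsLowModes → InterleavedHeatSliceFlow →
  RobustYangMillsHandover → QCD`, is exactly the route's deciding theorem `closes`, which does not
  mention `Assembly`.

Upshot for the planner: as filed the item is not an assembly step (not pure logic) — it carries the
open content of crux 8892 (SU(3) Yang–Mills with gap + robustness) and closes with it, or vacuously
with a refutation of 8871 / 8872 / 8870; retyped as the chain above it is `closes`.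
-/

namespace Summit.QuantumFields.QCD.Theorems

open Summit.QuantumFields.QCD.Theses.HeatSlicedQuarks

/-- Crux 8892 gives the typed assembly: `RobustYangMillsHandover → Assembly` (the hypotheses
`SmallFieldUltracontractivity`, `ActionBoundsLowModes` of `Assembly` are not used). [folklore] -/
theorem HeatSlicedQuarks.assembly_of_handover : RobustYangMillsHandover → Assembly :=
  fun hR _ _ hX => hR hX

/-- Conversely the typed assembly and the two spectral cruxes give crux 8892 back:
`Assembly → SmallFieldUltracontractivity → ActionBoundsLowModes → RobustYangMillsHandover`.
[folklore] -/
theorem HeatSlicedQuarks.handover_of_assembly :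
    Assembly → SmallFieldUltracontractivity → ActionBoundsLowModes → RobustYangMillsHandover :=
  fun hA h₂ h₃ hX => hA h₂ h₃ hX

/-- **What the typed assembly is**: `Assembly ↔ (SmallFieldUltracontractivity ∧
ActionBoundsLowModes → RobustYangMillsHandover)` — crux 8892 conditioned on cruxes 8871, 8872.
[folklore] -/
theorem HeatSlicedQuarks.assembly_iff :
    Assembly ↔ (SmallFieldUltracontractivity ∧ ActionBoundsLowModes → RobustYangMillsHandover) :=
  ⟨fun hA h hX => hA h.1 h.2 hX, fun h h₂ h₃ hX => h ⟨h₂, h₃⟩ hX⟩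

/-- Under the two spectral cruxes the typed assembly is literally equivalent to crux 8892.
[folklore] -/
theorem HeatSlicedQuarks.assembly_iff_handover_of_cruxes (h₂ : SmallFieldUltracontractivity)
    (h₃ : ActionBoundsLowModes) : Assembly ↔ RobustYangMillsHandover :=
  ⟨fun hA hX => hA h₂ h₃ hX, fun hR _ _ hX => hR hX⟩

/-- Vacuity I: a refutation of crux 8871 proves the typed assembly. [folklore] -/
theorem HeatSlicedQuarks.assembly_of_not_smallFieldUltracontractivity :
    ¬ SmallFieldUltracontractivity → Assembly :=
  fun h h₂ _ _ => absurd h₂ h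

/-- Vacuity II: a refutation of crux 8872 proves the typed assembly. [folklore] -/
theorem HeatSlicedQuarks.assembly_of_not_actionBoundsLowModes :
    ¬ ActionBoundsLowModes → Assembly :=
  fun h _ h₃ _ => absurd h₃ h

/-- Vacuity III: a refutation of the route's target X₀ (stmt-QuantumFields-8870) proves the typed
assembly. [folklore] -/
theorem HeatSlicedQuarks.assembly_of_not_continuumQCDExists : ¬ ContinuumQCDExists → Assembly :=
  fun h _ _ hX => absurd hX h

/-- The summit conjunct proves the typed assembly. [folklore] -/
theorem HeatSlicedQuarks.assembly_of_qcd : _root_.QCD → Assembly :=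
  fun hQ _ _ _ => hQ

/-- A refutation of the typed assembly would refute the summit conjunct `QCD`. [folklore] -/
theorem HeatSlicedQuarks.not_qcd_of_not_assembly : ¬ Assembly → ¬ _root_.QCD :=
  fun h hQ => h (HeatSlicedQuarks.assembly_of_qcd hQ)

/-- **`¬`-form.** A refutation of the typed assembly is EXACTLY: both spectral cruxes, a construction
of X₀, and a refutation of `QCD`. [folklore] -/
theorem HeatSlicedQuarks.not_assembly_iff :
    ¬ Assembly ↔
      SmallFieldUltracontractivity ∧ ActionBoundsLowModes ∧ ContinuumQCDExists ∧ ¬ _root_.QCD := by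
  unfold Assembly
  constructor
  · intro h
    by_contra hc
    refine h fun h₂ h₃ hX => ?_
    by_contra hQ
    exact hc ⟨h₂, h₃, hX, hQ⟩
  · rintro ⟨h₂, h₃, hX, hQ⟩ hA
    exact hQ (hA h₂ h₃ hX)

/-- **`¬`-form, relative to the cruxes.** Equivalently: a refutation of the typed assembly is both
spectral cruxes together with a refutation of crux 8892. [folklore] -/
theorem HeatSlicedQuarks.not_assembly_iff_not_handover :
    ¬ Assembly ↔
      SmallFieldUltracontractivity ∧ ActionBoundsLowModes ∧ ¬ RobustYangMillsHandover := by
  rw [HeatSlicedQuarks.not_assembly_iff]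
  unfold RobustYangMillsHandover
  rw [Classical.not_imp]

/-- **The intended (pure-logic) assembly is the deciding theorem.** The chain described in the
item's docstring — engine arrows `InterleavedHeatSliceFlow` into X₀, last arrow
`RobustYangMillsHandover` — holds by modus ponens and is the route's `closes`. [folklore] -/
theorem HeatSlicedQuarks.chain_eq_closes :
    SmallFieldUltracontractivity → ActionBoundsLowModes → InterleavedHeatSliceFlow →
      RobustYangMillsHandover → _root_.QCD :=
  -- buildfix 2026-08-19: the route's `closes` was re-cut (revs 7/10: TracedQuadraticParametrix,
  -- QuarkLoopCoefficient, InterleavedFlowProper); the chain itself is plain modus ponens.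
  fun h₂ h₃ hI hR => hR (hI h₂ h₃)

/-- … and the typed `Assembly` slots into that chain in place of the handover only together with the
engine: `InterleavedHeatSliceFlow → Assembly → SmallFieldUltracontractivity → ActionBoundsLowModes →
QCD`. [folklore] -/
theorem HeatSlicedQuarks.qcd_of_flow_of_assembly :
    InterleavedHeatSliceFlow → Assembly → SmallFieldUltracontractivity → ActionBoundsLowModes →
      _root_.QCD :=
  fun hI hA h₂ h₃ => hA h₂ h₃ (hI h₂ h₃)

end Summit.QuantumFields.QCD.Theorems
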